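import Summits.CriticalPhenomena.PercolationContinuityZ3.Theorems.PercNearOneGluingNoHeavyLowerTailSahiRecursionCert
import Literature.Combinatorics.Sahi2008.Symmetry
import Mathlib.Data.Fin.Tuple.Sort

/-!
# `NoHeavyLowerTail` (stmt-CriticalPhenomena-4575) — Sahi's `E_5, E_6` on the NON-ABSORBING families of a cube: the pruned enumeration,
# its extraction lemmas, and the reduction of an arbitrary non-absorbing family to a sorted tuple

Support file, seat `prim-l12-p5` (gen 5), `--supports stmt-CriticalPhenomena-4575`; continues `…SahiRecursionCert` (digit test `checkFamW` of one
family, sound at every order).  A family of events is NON-ABSORBING if no member contains the intersection of the others (the residual class of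
Theorem G′ / `…SahiCubeFourResidual`: absorbing families are settled by the lower orders).  Here:

* `meetL`, `nonAbsL` — bitmask form of "no member of the list absorbs the AND of the others"; `nonAbsL_take_of_nonabsorbing`: every PREFIX of the
  bitmask list of a non-absorbing family of events passes it (an absorber of a sub-family absorbs in the family);
* `ktTab`/`ktLook` — a table of the Kronecker numbers of the increasing bitmasks (`ktLook_ktTab`: agrees with `krTB`), so that the recursion
  `sahiKr` looks numbers up instead of recomputing them;
* `checkR5W m KT F off offN rowP`, `checkR6W …` — the digit test for every SORTED quintuple (sextuple) of increasing bitmasks of the `m`-cube whose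
  first member satisfies the row predicate `rowP`, short-circuiting on unsorted tuples and on prefixes with an absorbing member (closed Boolean
  expressions for `native_decide`, evaluated row by row in `…SahiCubeFourResidualFive*/Six*`); extraction `checkFamW_of_checkR5W/6W`;
* **`sahiE_five_ind_nonneg_of_rows`, `sahiE_six_ind_nonneg_of_rows`** — if rows covering all increasing bitmasks pass, then `E_5 ≥ 0` (`E_6 ≥ 0`)
  under EVERY product measure for EVERY non-absorbing quintuple (sextuple) of increasing events of `Set (Fin m)` (sort the bitmasks with
  `Tuple.sort`, `E_n` is symmetric: `sahiE_comp_perm`).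

No sorries, no named facts; nothing is evaluated in this file.
-/

namespace Summit.CriticalPhenomena.PercolationContinuityZ3.Theorems.NCopyCert

open Finset OneCutCert SahiC3Cube MeasureTheory
open scoped BigOperators
open Literature.Combinatorics.Sahi2008 (sahiE bernoulliWeight sahiE_comp_perm)
open Literature.Probability.Percolation.DecisionTree (ind)

/-! ## A table of Kronecker numbers of the increasing bitmasks -/

/-- The Kronecker numbers (base `2^σ`, positions in base `b`) of all increasing bitmasks of the `m`-cube, indexed by the bitmask (other
entries `0`). [this work] -/
def ktTab (σ b m : ℕ) : Array ℤ :=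
  ((List.range (2 ^ (2 ^ m))).map fun T => if isUpN m T = true then (krTB σ b m T : ℤ) else 0).toArray

/-- Table-backed Kronecker number of a bitmask table (falls back to `krTB` outside the table). [this work] -/
def ktLook (σ b m : ℕ) (tab : Array ℤ) (T : ℕ) : ℤ :=
  if isUpN m T = true ∧ T < 2 ^ (2 ^ m) then (tab[T]?).getD 0 else (krTB σ b m T : ℤ)

/-- The table lookup agrees with `krTB`. [this work] -/
theorem ktLook_ktTab (σ b m T : ℕ) : ktLook σ b m (ktTab σ b m) T = (krTB σ b m T : ℤ) := by
  unfold ktLook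
  split_ifs with h
  · obtain ⟨hup, hlt⟩ := h
    unfold ktTab
    rw [List.getElem?_toArray, List.getElem?_map, List.getElem?_range hlt]
    simp [hup]
  · rfl

/-! ## Absorption on lists of bitmasks -/

/-- The AND of a list of bitmasks of the `m`-cube (empty list: the whole cube). [this work] -/
def meetL (m : ℕ) : List ℕ → ℕ
  | [] => fullN m
  | t :: l => t &&& meetL m l

/-- No member of the list contains (bitwise) the AND of the other members. [this work] -/
def nonAbsL (m : ℕ) (l : List ℕ) : Bool :=
  (List.range l.length).all fun q =>
    !decide (meetL m (l.take q ++ l.drop (q + 1)) &&& l.getD q 0 = meetL m (l.take q ++ l.drop (q + 1)))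

/-- Bits of `meetL`. [this work] -/
theorem testBit_meetL (m : ℕ) (x : ℕ) : ∀ l : List ℕ, (meetL m l).testBit x = (decide (x < 2 ^ m) && l.all fun t => t.testBit x)
  | [] => by simp [meetL, fullN, Nat.testBit_two_pow_sub_one]
  | t :: l => by
    rw [meetL, Nat.testBit_land, testBit_meetL m x l, List.all_cons]
    cases t.testBit x <;> simp

/-- **Prefixes of a non-absorbing family pass `nonAbsL`**: if no member of the family of events `A` contains the intersection of the others,
then for every `j` no member of the first `j` bitmasks contains the AND of the other first `j` bitmasks. [this work] -/
theorem nonAbsL_take_of_nonabsorbing {m n : ℕ} (A : Fin n → Set (Set (Fin m)))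
    (hna : ∀ q : Fin n, ∃ ω, (∀ i, i ≠ q → ω ∈ A i) ∧ ω ∉ A q) (j : ℕ) :
    nonAbsL m ((List.ofFn fun i => encA m (A i)).take j) = true := by
  classical
  set L := (List.ofFn fun i => encA m (A i)).take j with hL
  unfold nonAbsL
  rw [List.all_eq_true]
  intro q hq
  rw [List.mem_range] at hq
  have hqn : q < n := by
    have : L.length ≤ n := by rw [hL, List.length_take, List.length_ofFn]; exact min_le_right _ _
    omega
  set i₀ : Fin n := ⟨q, hqn⟩ with hi₀
  obtain ⟨ω, hω, hω₀⟩ := hna i₀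
  -- the corner code of `ω`
  set g : Fin m → Bool := fun i => decide (i ∈ ω) with hg
  have hpt : pt m (enc2 g) = ω := by
    rw [pt_enc2]; ext i; simp [g]
  have tbit : ∀ X : Set (Set (Fin m)), (encA m X).testBit (enc2 g) = decide (ω ∈ X) := by
    intro X; rw [testBit_encA, hpt]; simp [enc2_lt g]
  -- entries of `L`
  have hLget : ∀ (r : ℕ) (hr : r < L.length), L[r] = encA m (A ⟨r, by
      have : L.length ≤ n := by rw [hL, List.length_take, List.length_ofFn]; exact min_le_right _ _
      omega⟩) := by
    intro r hr
    simp only [hL, List.getElem_take, List.getElem_ofFn]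
  have hq0 : L.getD q 0 = encA m (A i₀) := by
    rw [List.getD_eq_getElem?_getD, List.getElem?_eq_getElem hq, Option.getD_some, hLget q hq]
  -- every OTHER entry contains `ω`
  have hothers : ∀ t ∈ L.take q ++ L.drop (q + 1), t.testBit (enc2 g) = true := by
    intro t ht
    rw [List.mem_append] at ht
    rcases ht with ht | ht
    · obtain ⟨r, hr, rfl⟩ := List.getElem_of_mem ht
      rw [List.length_take] at hr
      rw [List.getElem_take, hLget r (by omega), tbit, decide_eq_true_eq]
      exact hω _ (by intro h; rw [Fin.ext_iff] at h; simp [hi₀] at h; omega)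
    · obtain ⟨r, hr, rfl⟩ := List.getElem_of_mem ht
      rw [List.length_drop] at hr
      rw [List.getElem_drop, hLget (q + 1 + r) (by omega), tbit, decide_eq_true_eq]
      exact hω _ (by intro h; rw [Fin.ext_iff] at h; simp [hi₀] at h; omega)
  have hmeet : (meetL m (L.take q ++ L.drop (q + 1))).testBit (enc2 g) = true := by
    rw [testBit_meetL]
    simp only [enc2_lt g, decide_true, Bool.true_and]
    exact List.all_eq_true.mpr hothers
  -- so position `q` does not absorb
  simp only [Bool.not_eq_true', decide_eq_false_iff_not]
  intro habs
  have hb := congrArg (fun t => Nat.testBit t (enc2 g)) habs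
  simp only [Nat.testBit_land, hmeet, hq0, tbit, Bool.true_and, decide_eq_true_eq] at hb
  exact hω₀ hb

/-! ## The pruned enumeration of sorted quintuples / sextuples, by rows -/

/-- **Row of the order-5 check**: for every sorted quintuple `a ≤ b ≤ c ≤ d ≤ e` of increasing bitmasks of the `m`-cube with `rowP a`, either some
prefix has an absorbing member or the digit test of order `5` passes (short-circuiting Boolean expression). [this work] -/
def checkR5W (m : ℕ) (KT : ℕ → ℤ) (F off : ℤ) (offN : ℕ) (rowP : ℕ → Bool) : Bool :=
  let U := upsN m
  U.all fun a => !rowP a || U.all fun b => decide (b < a) || !nonAbsL m [a, b] ||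
    U.all fun c => decide (c < b) || !nonAbsL m [a, b, c] ||
      U.all fun d => decide (d < c) || !nonAbsL m [a, b, c, d] ||
        U.all fun e => decide (e < d) || !nonAbsL m [a, b, c, d, e] || checkFamW KT F off offN 5 ![a, b, c, d, e]

/-- **Row of the order-6 check** (same, one level deeper). [this work] -/
def checkR6W (m : ℕ) (KT : ℕ → ℤ) (F off : ℤ) (offN : ℕ) (rowP : ℕ → Bool) : Bool :=
  let U := upsN m
  U.all fun a => !rowP a || U.all fun b => decide (b < a) || !nonAbsL m [a, b] ||
    U.all fun c => decide (c < b) || !nonAbsL m [a, b, c] ||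
      U.all fun d => decide (d < c) || !nonAbsL m [a, b, c, d] ||
        U.all fun e => decide (e < d) || !nonAbsL m [a, b, c, d, e] ||
          U.all fun f => decide (f < e) || !nonAbsL m [a, b, c, d, e, f] || checkFamW KT F off offN 6 ![a, b, c, d, e, f]

/-- Extraction (order 5): a sorted quintuple of increasing bitmasks in the row, all of whose prefixes pass `nonAbsL`, passes the digit test.
[this work] -/
theorem checkFamW_of_checkR5W {m : ℕ} {KT : ℕ → ℤ} {F off : ℤ} {offN : ℕ} {rowP : ℕ → Bool}
    (h : checkR5W m KT F off offN rowP = true) {a b c d e : ℕ}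
    (ha : a ∈ upsN m) (hb : b ∈ upsN m) (hc : c ∈ upsN m) (hd : d ∈ upsN m) (he : e ∈ upsN m) (hrow : rowP a = true)
    (hab : a ≤ b) (hbc : b ≤ c) (hcd : c ≤ d) (hde : d ≤ e)
    (n2 : nonAbsL m [a, b] = true) (n3 : nonAbsL m [a, b, c] = true) (n4 : nonAbsL m [a, b, c, d] = true)
    (n5 : nonAbsL m [a, b, c, d, e] = true) :
    checkFamW KT F off offN 5 ![a, b, c, d, e] = true := by
  unfold checkR5W at h
  simp only [List.all_eq_true, Bool.or_eq_true, Bool.not_eq_true', decide_eq_true_eq] at h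
  rcases h a ha with k | h
  · rw [k] at hrow; exact absurd hrow Bool.false_ne_true
  rcases h b hb with (k | k) | h
  · exact absurd hab (not_le.2 k)
  · rw [k] at n2; exact absurd n2 Bool.false_ne_true
  rcases h c hc with (k | k) | h
  · exact absurd hbc (not_le.2 k)
  · rw [k] at n3; exact absurd n3 Bool.false_ne_true
  rcases h d hd with (k | k) | h
  · exact absurd hcd (not_le.2 k)
  · rw [k] at n4; exact absurd n4 Bool.false_ne_true
  rcases h e he with (k | k) | h
  · exact absurd hde (not_le.2 k)
  · rw [k] at n5; exact absurd n5 Bool.false_ne_true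
  exact h

/-- Extraction (order 6). [this work] -/
theorem checkFamW_of_checkR6W {m : ℕ} {KT : ℕ → ℤ} {F off : ℤ} {offN : ℕ} {rowP : ℕ → Bool}
    (h : checkR6W m KT F off offN rowP = true) {a b c d e f : ℕ}
    (ha : a ∈ upsN m) (hb : b ∈ upsN m) (hc : c ∈ upsN m) (hd : d ∈ upsN m) (he : e ∈ upsN m) (hf : f ∈ upsN m)
    (hrow : rowP a = true) (hab : a ≤ b) (hbc : b ≤ c) (hcd : c ≤ d) (hde : d ≤ e) (hef : e ≤ f)
    (n2 : nonAbsL m [a, b] = true) (n3 : nonAbsL m [a, b, c] = true) (n4 : nonAbsL m [a, b, c, d] = true)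
    (n5 : nonAbsL m [a, b, c, d, e] = true) (n6 : nonAbsL m [a, b, c, d, e, f] = true) :
    checkFamW KT F off offN 6 ![a, b, c, d, e, f] = true := by
  unfold checkR6W at h
  simp only [List.all_eq_true, Bool.or_eq_true, Bool.not_eq_true', decide_eq_true_eq] at h
  rcases h a ha with k | h
  · rw [k] at hrow; exact absurd hrow Bool.false_ne_true
  rcases h b hb with (k | k) | h
  · exact absurd hab (not_le.2 k)
  · rw [k] at n2; exact absurd n2 Bool.false_ne_true
  rcases h c hc with (k | k) | h
  · exact absurd hbc (not_le.2 k)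
  · rw [k] at n3; exact absurd n3 Bool.false_ne_true
  rcases h d hd with (k | k) | h
  · exact absurd hcd (not_le.2 k)
  · rw [k] at n4; exact absurd n4 Bool.false_ne_true
  rcases h e he with (k | k) | h
  · exact absurd hde (not_le.2 k)
  · rw [k] at n5; exact absurd n5 Bool.false_ne_true
  rcases h f hf with (k | k) | h
  · exact absurd hef (not_le.2 k)
  · rw [k] at n6; exact absurd n6 Bool.false_ne_true
  exact h

/-! ## From rows to every non-absorbing family -/

/-- Reindexing a non-absorbing family by a permutation keeps it non-absorbing. [this work] -/
theorem nonabsorbing_comp_perm {m n : ℕ} {A : Fin n → Set (Set (Fin m))}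
    (hna : ∀ q : Fin n, ∃ ω, (∀ i, i ≠ q → ω ∈ A i) ∧ ω ∉ A q) (σ : Equiv.Perm (Fin n)) :
    ∀ q : Fin n, ∃ ω, (∀ i, i ≠ q → ω ∈ A (σ i)) ∧ ω ∉ A (σ q) := by
  intro q
  obtain ⟨ω, hω, hω'⟩ := hna (σ q)
  exact ⟨ω, fun i hi => hω (σ i) (fun h => hi (σ.injective h)), hω'⟩

/-- **`E_5 ≥ 0` on every non-absorbing quintuple from passing rows.**  If rows of the order-5 check covering all increasing bitmasks of the
`m`-cube pass (digit base `2^σ` with `coefBound m 5 < 2^(σ−1)`, any `KT` agreeing with `krTB σ 6 m`), then for every product weight and every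
non-absorbing quintuple of increasing events of `Set (Fin m)`, `E_5(1_{A_0},…,1_{A_4}) ≥ 0`. [this work] -/
theorem sahiE_five_ind_nonneg_of_rows {m σ : ℕ} (hσ : 0 < σ) (hbnd : coefBound m 5 < 2 ^ (σ - 1))
    {KT : ℕ → ℤ} (hKT : ∀ T, KT T = (krTB σ 6 m T : ℤ)) (rows : List (ℕ → Bool))
    (hcover : ∀ a ∈ upsN m, ∃ r ∈ rows, r a = true)
    (hrows : ∀ r ∈ rows, checkR5W m KT (krTB σ 6 m (fullN m)) (maskN σ (6 ^ m)) (maskN σ (6 ^ m)) r = true)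
    (p : Fin m → unitInterval) (A : Fin 5 → Set (Set (Fin m))) (hup : ∀ i, IsUpperSet (A i))
    (hna : ∀ q : Fin 5, ∃ ω, (∀ i, i ≠ q → ω ∈ A i) ∧ ω ∉ A q) :
    0 ≤ sahiE (bernoulliWeight p) 5 (fun i => ind (A i)) := by
  classical
  set τ := Tuple.sort (fun i => encA m (A i)) with hτ
  have hmono : Monotone ((fun i => encA m (A i)) ∘ τ) := Tuple.monotone_sort _
  rw [← sahiE_comp_perm (bernoulliWeight p) 5 τ (fun i => ind (A i))]
  set A' : Fin 5 → Set (Set (Fin m)) := fun i => A (τ i) with hA'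
  show 0 ≤ sahiE (bernoulliWeight p) 5 (fun i => ind (A' i))
  have hup' : ∀ i, IsUpperSet (A' i) := fun i => hup _
  have hna' : ∀ q : Fin 5, ∃ ω, (∀ i, i ≠ q → ω ∈ A' i) ∧ ω ∉ A' q := nonabsorbing_comp_perm hna τ
  set a : Fin 5 → ℕ := fun i => encA m (A' i) with ha
  have hle : ∀ i j : Fin 5, i ≤ j → a i ≤ a j := fun i j hij => hmono hij
  have hmem : ∀ i, a i ∈ upsN m := fun i => encA_mem_upsN (hup' i)
  obtain ⟨r, hr, hra⟩ := hcover (a 0) (hmem 0)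
  have hpre := nonAbsL_take_of_nonabsorbing A' hna'
  have hL : (List.ofFn fun i => encA m (A' i)) = [a 0, a 1, a 2, a 3, a 4] := by simp [List.ofFn_succ, ha]
  rw [hL] at hpre
  have key := checkFamW_of_checkR5W (hrows r hr) (hmem 0) (hmem 1) (hmem 2) (hmem 3) (hmem 4) hra
    (hle 0 1 (by decide)) (hle 1 2 (by decide)) (hle 2 3 (by decide)) (hle 3 4 (by decide))
    (hpre 2) (hpre 3) (hpre 4) (hpre 5)
  have hvec : (![a 0, a 1, a 2, a 3, a 4] : Fin 5 → ℕ) = fun i => encA m (A' i) := by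
    funext i; fin_cases i <;> rfl
  rw [hvec] at key
  exact sahiE_ind_nonneg_of_checkFamW hσ hbnd hKT p A' key

/-- **`E_6 ≥ 0` on every non-absorbing sextuple from passing rows** (same, order 6). [this work] -/
theorem sahiE_six_ind_nonneg_of_rows {m σ : ℕ} (hσ : 0 < σ) (hbnd : coefBound m 6 < 2 ^ (σ - 1))
    {KT : ℕ → ℤ} (hKT : ∀ T, KT T = (krTB σ 7 m T : ℤ)) (rows : List (ℕ → Bool))
    (hcover : ∀ a ∈ upsN m, ∃ r ∈ rows, r a = true)
    (hrows : ∀ r ∈ rows, checkR6W m KT (krTB σ 7 m (fullN m)) (maskN σ (7 ^ m)) (maskN σ (7 ^ m)) r = true)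
    (p : Fin m → unitInterval) (A : Fin 6 → Set (Set (Fin m))) (hup : ∀ i, IsUpperSet (A i))
    (hna : ∀ q : Fin 6, ∃ ω, (∀ i, i ≠ q → ω ∈ A i) ∧ ω ∉ A q) :
    0 ≤ sahiE (bernoulliWeight p) 6 (fun i => ind (A i)) := by
  classical
  set τ := Tuple.sort (fun i => encA m (A i)) with hτ
  have hmono : Monotone ((fun i => encA m (A i)) ∘ τ) := Tuple.monotone_sort _
  rw [← sahiE_comp_perm (bernoulliWeight p) 6 τ (fun i => ind (A i))]
  set A' : Fin 6 → Set (Set (Fin m)) := fun i => A (τ i) with hA'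
  show 0 ≤ sahiE (bernoulliWeight p) 6 (fun i => ind (A' i))
  have hup' : ∀ i, IsUpperSet (A' i) := fun i => hup _
  have hna' : ∀ q : Fin 6, ∃ ω, (∀ i, i ≠ q → ω ∈ A' i) ∧ ω ∉ A' q := nonabsorbing_comp_perm hna τ
  set a : Fin 6 → ℕ := fun i => encA m (A' i) with ha
  have hle : ∀ i j : Fin 6, i ≤ j → a i ≤ a j := fun i j hij => hmono hij
  have hmem : ∀ i, a i ∈ upsN m := fun i => encA_mem_upsN (hup' i)
  obtain ⟨r, hr, hra⟩ := hcover (a 0) (hmem 0)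
  have hpre := nonAbsL_take_of_nonabsorbing A' hna'
  have hL : (List.ofFn fun i => encA m (A' i)) = [a 0, a 1, a 2, a 3, a 4, a 5] := by simp [List.ofFn_succ, ha]
  rw [hL] at hpre
  have key := checkFamW_of_checkR6W (hrows r hr) (hmem 0) (hmem 1) (hmem 2) (hmem 3) (hmem 4) (hmem 5) hra
    (hle 0 1 (by decide)) (hle 1 2 (by decide)) (hle 2 3 (by decide)) (hle 3 4 (by decide)) (hle 4 5 (by decide))
    (hpre 2) (hpre 3) (hpre 4) (hpre 5) (hpre 6)
  have hvec : (![a 0, a 1, a 2, a 3, a 4, a 5] : Fin 6 → ℕ) = fun i => encA m (A' i) := by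
    funext i; fin_cases i <;> rfl
  rw [hvec] at key
  exact sahiE_ind_nonneg_of_checkFamW hσ hbnd hKT p A' key

end Summit.CriticalPhenomena.PercolationContinuityZ3.Theorems.NCopyCert
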